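import Summits.AtomisticToContinuum.Crystallization.Theorems.HullExactificationCascadeRobustBarlowTemplateTransportDefs
import Mathlib.Analysis.InnerProductSpace.PiL2
import Mathlib.LinearAlgebra.FiniteDimensional.Lemmas

/-!
# `injective_linearBound` for line `registered` (crux `RobustBarlowTemplate`, stmt-AtomisticToContinuum-12088)

## Statement
`injective_linearBound`: if three vectors `b₁, b₂, b₃` of Euclidean `3`-space satisfy the lower
frame bound `μ · √(c₁² + c₂² + c₃²) ≤ ‖c₁ b₁ + c₂ b₂ + c₃ b₃‖` with `μ > 0`, then every linear map
`T` with `‖T bᵢ‖ ≤ ηᵢ` satisfies `‖T x‖ ≤ (√(η₁² + η₂² + η₃²) / μ) · ‖x‖`.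

## Proof outline
The frame bound with `μ > 0` makes `b₁, b₂, b₃` linearly independent (a vanishing combination has
`√(Σ cᵢ²) ≤ 0`), hence — three vectors in the `3`-dimensional space `E3` — spanning; so
`x = Σ cᵢ bᵢ`, and
`‖T x‖ ≤ Σ |cᵢ| ηᵢ ≤ √(Σ cᵢ²) · √(Σ ηᵢ²) ≤ (‖x‖ / μ) · √(Σ ηᵢ²)`
(Cauchy–Schwarz in `ℝ³` via the Lagrange identity, then the frame bound).

## Contents
* `injective_exists_coords` — coordinates with respect to a family with a lower frame bound;
* `injective_linearBound` — the registered sub-goal;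
* `injective_norm_comb_sq`, `injective_mul_sqrt_le_norm` — Gram expansion of
  `‖c₁ b₁ + c₂ b₂ + c₃ b₃‖²` and the passage from squares to the frame bound;
* `injective_gram_regular`, `injective_gram_quarterPole`, `injective_gram_quarterEquator` — the
  frame constants `√(1/2)`, `√(3/10)`, `1/2` for the edge frames of the two cell shapes of the
  refined Barlow honeycomb (regular tetrahedron; quarter octahedron seen from a pole and from an
  equatorial vertex), each by an explicit sum-of-squares decomposition of the Gram form minus the
  constant times the identity.
-/

noncomputable section

namespace Summit.AtomisticToContinuum.Crystallization.Theorems.HullExactificationCascadeRobustBarlowTemplate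

open RealInnerProductSpace

/-- Euclidean `3`-space. -/
local notation "E3" => EuclideanSpace ℝ (Fin 3)

/-- A family `b₁, b₂, b₃` in `E3` with a positive lower frame bound spans: every vector has
coordinates with respect to it. -/
theorem injective_exists_coords (b₁ b₂ b₃ : E3) (μ : ℝ) (hμ : 0 < μ)
    (hlow : ∀ c₁ c₂ c₃ : ℝ,
      μ * Real.sqrt (c₁ ^ 2 + c₂ ^ 2 + c₃ ^ 2) ≤ ‖c₁ • b₁ + c₂ • b₂ + c₃ • b₃‖)
    (x : E3) : ∃ c₁ c₂ c₃ : ℝ, x = c₁ • b₁ + c₂ • b₂ + c₃ • b₃ := by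
  set b : Fin 3 → E3 := ![b₁, b₂, b₃]
  have hli : LinearIndependent ℝ b := by
    rw [Fintype.linearIndependent_iff]
    intro g hg
    have hsum : g 0 • b₁ + g 1 • b₂ + g 2 • b₃ = 0 := by
      simpa [Fin.sum_univ_three, b] using hg
    have h0 := hlow (g 0) (g 1) (g 2)
    rw [hsum, norm_zero] at h0
    have hsq : Real.sqrt (g 0 ^ 2 + g 1 ^ 2 + g 2 ^ 2) ≤ 0 := by
      by_contra hcon
      push Not at hcon
      have := mul_pos hμ hcon
      linarith
    have hzero : g 0 ^ 2 + g 1 ^ 2 + g 2 ^ 2 ≤ 0 :=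
      Real.sqrt_eq_zero'.mp (le_antisymm hsq (Real.sqrt_nonneg _))
    have s0 := sq_nonneg (g 0)
    have s1 := sq_nonneg (g 1)
    have s2 := sq_nonneg (g 2)
    have e0 : g 0 = 0 := pow_eq_zero_iff two_ne_zero |>.mp (by linarith)
    have e1 : g 1 = 0 := pow_eq_zero_iff two_ne_zero |>.mp (by linarith)
    have e2 : g 2 = 0 := pow_eq_zero_iff two_ne_zero |>.mp (by linarith)
    intro i
    fin_cases i
    · exact e0
    · exact e1
    · exact e2
  have hspan : Submodule.span ℝ (Set.range b) = ⊤ :=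
    hli.span_eq_top_of_card_eq_finrank (by simp)
  have hx : x ∈ Submodule.span ℝ (Set.range b) := by
    rw [hspan]
    exact Submodule.mem_top
  obtain ⟨c, hc⟩ := (Submodule.mem_span_range_iff_exists_fun ℝ).mp hx
  refine ⟨c 0, c 1, c 2, ?_⟩
  rw [← hc, Fin.sum_univ_three]
  simp [b]

/-- SUB-GOAL `injective_linearBound` (registered; toward `develop_injective`, piece I5): a linear map
that is small on a well-conditioned basis is small. -/
theorem injective_linearBound :
    ∀ (b₁ b₂ b₃ : E3) (μ : ℝ), 0 < μ →
      (∀ c₁ c₂ c₃ : ℝ, μ * Real.sqrt (c₁ ^ 2 + c₂ ^ 2 + c₃ ^ 2) ≤ ‖c₁ • b₁ + c₂ • b₂ + c₃ • b₃‖) →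
      ∀ (T : E3 →ₗ[ℝ] E3) (η₁ η₂ η₃ : ℝ), ‖T b₁‖ ≤ η₁ → ‖T b₂‖ ≤ η₂ → ‖T b₃‖ ≤ η₃ →
        ∀ x : E3, ‖T x‖ ≤ Real.sqrt (η₁ ^ 2 + η₂ ^ 2 + η₃ ^ 2) / μ * ‖x‖ := by
  intro b₁ b₂ b₃ μ hμ hlow T η₁ η₂ η₃ h₁ h₂ h₃ x
  -- coordinates of `x`
  obtain ⟨c₁, c₂, c₃, rfl⟩ := injective_exists_coords b₁ b₂ b₃ μ hμ hlow x
  have hη₁ : 0 ≤ η₁ := (norm_nonneg _).trans h₁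
  have hη₂ : 0 ≤ η₂ := (norm_nonneg _).trans h₂
  have hη₃ : 0 ≤ η₃ := (norm_nonneg _).trans h₃
  set A := Real.sqrt (c₁ ^ 2 + c₂ ^ 2 + c₃ ^ 2)
  set B := Real.sqrt (η₁ ^ 2 + η₂ ^ 2 + η₃ ^ 2)
  have hA0 : 0 ≤ A := Real.sqrt_nonneg _
  have hB0 : 0 ≤ B := Real.sqrt_nonneg _
  have hA2 : A ^ 2 = c₁ ^ 2 + c₂ ^ 2 + c₃ ^ 2 := Real.sq_sqrt (by positivity)
  have hB2 : B ^ 2 = η₁ ^ 2 + η₂ ^ 2 + η₃ ^ 2 := Real.sq_sqrt (by positivity)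
  -- the image of the combination, term by term
  have hTx : ‖T (c₁ • b₁ + c₂ • b₂ + c₃ • b₃)‖ ≤ |c₁| * η₁ + |c₂| * η₂ + |c₃| * η₃ := by
    rw [map_add, map_add, map_smul, map_smul, map_smul]
    refine norm_add₃_le.trans ?_
    rw [norm_smul, norm_smul, norm_smul, Real.norm_eq_abs, Real.norm_eq_abs, Real.norm_eq_abs]
    gcongr
  -- Cauchy–Schwarz in `ℝ³` (Lagrange identity)
  have hCS : |c₁| * η₁ + |c₂| * η₂ + |c₃| * η₃ ≤ A * B := by
    refine le_of_sq_le_sq ?_ (mul_nonneg hA0 hB0)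
    rw [mul_pow, hA2, hB2]
    nlinarith [sq_nonneg (|c₁| * η₂ - |c₂| * η₁), sq_nonneg (|c₁| * η₃ - |c₃| * η₁),
      sq_nonneg (|c₂| * η₃ - |c₃| * η₂), sq_abs c₁, sq_abs c₂, sq_abs c₃]
  calc ‖T (c₁ • b₁ + c₂ • b₂ + c₃ • b₃)‖ ≤ A * B := hTx.trans hCS
    _ = B / μ * (μ * A) := by field_simp
    _ ≤ B / μ * ‖c₁ • b₁ + c₂ • b₂ + c₃ • b₃‖ :=
        mul_le_mul_of_nonneg_left (hlow c₁ c₂ c₃) (div_nonneg hB0 hμ.le)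

/-! ## Frame constants of the two cell shapes -/

/-- Gram expansion of the squared norm of a three-term combination. -/
theorem injective_norm_comb_sq (b₁ b₂ b₃ : E3) (c₁ c₂ c₃ : ℝ) :
    ‖c₁ • b₁ + c₂ • b₂ + c₃ • b₃‖ ^ 2 =
      c₁ ^ 2 * ‖b₁‖ ^ 2 + c₂ ^ 2 * ‖b₂‖ ^ 2 + c₃ ^ 2 * ‖b₃‖ ^ 2 +
        2 * (c₁ * c₂) * ⟪b₁, b₂⟫ + 2 * (c₁ * c₃) * ⟪b₁, b₃⟫ + 2 * (c₂ * c₃) * ⟪b₂, b₃⟫ := by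
  rw [← real_inner_self_eq_norm_sq, ← real_inner_self_eq_norm_sq b₁,
    ← real_inner_self_eq_norm_sq b₂, ← real_inner_self_eq_norm_sq b₃]
  simp only [inner_add_left, inner_add_right, real_inner_smul_left, real_inner_smul_right]
  rw [real_inner_comm b₁ b₂, real_inner_comm b₁ b₃, real_inner_comm b₂ b₃]
  ring

/-- From a bound between squares to the frame bound `a · √S ≤ ‖v‖`. -/
theorem injective_mul_sqrt_le_norm {a S : ℝ} {v : E3} (hS : 0 ≤ S) (h : a ^ 2 * S ≤ ‖v‖ ^ 2) :
    a * Real.sqrt S ≤ ‖v‖ := by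
  rw [← Real.sqrt_sq (norm_nonneg v)]
  apply Real.le_sqrt_of_sq_le
  rw [mul_pow, Real.sq_sqrt hS]
  exact h

/-- Frame constant `√(1/2)` for the edge frame of a REGULAR TETRAHEDRON of edge `1` at a vertex
(unit vectors with pairwise inner products `1/2`):
`‖Σ cᵢ bᵢ‖² − ½ Σ cᵢ² = ½ (c₁ + c₂ + c₃)² ≥ 0`. -/
theorem injective_gram_regular :
    ∀ b₁ b₂ b₃ : E3, ‖b₁‖ = 1 → ‖b₂‖ = 1 → ‖b₃‖ = 1 →
      ⟪b₁, b₂⟫ = 1 / 2 → ⟪b₁, b₃⟫ = 1 / 2 → ⟪b₂, b₃⟫ = 1 / 2 → ∀ c₁ c₂ c₃ : ℝ,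
        Real.sqrt (1 / 2) * Real.sqrt (c₁ ^ 2 + c₂ ^ 2 + c₃ ^ 2) ≤
          ‖c₁ • b₁ + c₂ • b₂ + c₃ • b₃‖ := by
  intro b₁ b₂ b₃ h₁ h₂ h₃ h₁₂ h₁₃ h₂₃ c₁ c₂ c₃
  apply injective_mul_sqrt_le_norm (by positivity)
  rw [Real.sq_sqrt (by norm_num), injective_norm_comb_sq, h₁, h₂, h₃, h₁₂, h₁₃, h₂₃]
  nlinarith [sq_nonneg (c₁ + c₂ + c₃)]

/-- Frame constant `√(3/10)` for the edge frame of a QUARTER OCTAHEDRON `{v, v̄, E₁, E₂}` (two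
opposite vertices `v, v̄` of a regular octahedron of edge `1` and two adjacent equatorial ones) at
the POLE `v`: `b₁ = v̄ − v` (the diagonal, `‖b₁‖² = 2`), `b₂ = E₁ − v`, `b₃ = E₂ − v` (unit, with
`⟪b₁, b₂⟫ = ⟪b₁, b₃⟫ = 1`, `⟪b₂, b₃⟫ = 1/2`).  The Gram form minus `3/10` times the identity,
`1.7 c₁² + 0.7 c₂² + 0.7 c₃² + 2 c₁c₂ + 2 c₁c₃ + c₂c₃`, equals
`(17c₁ + 10c₂ + 10c₃)²/170 + (19c₂ − 15c₃)²/3230 + (4/95) c₃² ≥ 0`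
(the smallest eigenvalue of the Gram matrix is `(7 − √33)/4 ≈ 0.314 > 3/10`). -/
theorem injective_gram_quarterPole :
    ∀ b₁ b₂ b₃ : E3, ‖b₁‖ ^ 2 = 2 → ‖b₂‖ = 1 → ‖b₃‖ = 1 →
      ⟪b₁, b₂⟫ = 1 → ⟪b₁, b₃⟫ = 1 → ⟪b₂, b₃⟫ = 1 / 2 → ∀ c₁ c₂ c₃ : ℝ,
        Real.sqrt (3 / 10) * Real.sqrt (c₁ ^ 2 + c₂ ^ 2 + c₃ ^ 2) ≤
          ‖c₁ • b₁ + c₂ • b₂ + c₃ • b₃‖ := by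
  intro b₁ b₂ b₃ h₁ h₂ h₃ h₁₂ h₁₃ h₂₃ c₁ c₂ c₃
  apply injective_mul_sqrt_le_norm (by positivity)
  rw [Real.sq_sqrt (by norm_num), injective_norm_comb_sq, h₁, h₂, h₃, h₁₂, h₁₃, h₂₃]
  nlinarith [sq_nonneg (17 * c₁ + 10 * c₂ + 10 * c₃), sq_nonneg (19 * c₂ - 15 * c₃), sq_nonneg c₃]

/-- Frame constant `1/2` for the edge frame of a QUARTER OCTAHEDRON `{v, v̄, E₁, E₂}` at the
EQUATORIAL vertex `E₁`: `b₁ = v − E₁`, `b₂ = v̄ − E₁` (orthogonal unit vectors), `b₃ = E₂ − E₁`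
(unit, `⟪b₁, b₃⟫ = ⟪b₂, b₃⟫ = 1/2`).  The Gram form minus `1/4` times the identity,
`¾ c₁² + ¾ c₂² + ¾ c₃² + c₁c₃ + c₂c₃`, equals `((3c₁ + 2c₃)² + (3c₂ + 2c₃)² + c₃²)/12 ≥ 0`. -/
theorem injective_gram_quarterEquator :
    ∀ b₁ b₂ b₃ : E3, ‖b₁‖ = 1 → ‖b₂‖ = 1 → ‖b₃‖ = 1 →
      ⟪b₁, b₂⟫ = 0 → ⟪b₁, b₃⟫ = 1 / 2 → ⟪b₂, b₃⟫ = 1 / 2 → ∀ c₁ c₂ c₃ : ℝ,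
        (1 / 2 : ℝ) * Real.sqrt (c₁ ^ 2 + c₂ ^ 2 + c₃ ^ 2) ≤ ‖c₁ • b₁ + c₂ • b₂ + c₃ • b₃‖ := by
  intro b₁ b₂ b₃ h₁ h₂ h₃ h₁₂ h₁₃ h₂₃ c₁ c₂ c₃
  apply injective_mul_sqrt_le_norm (by positivity)
  rw [injective_norm_comb_sq, h₁, h₂, h₃, h₁₂, h₁₃, h₂₃]
  nlinarith [sq_nonneg (3 * c₁ + 2 * c₃), sq_nonneg (3 * c₂ + 2 * c₃), sq_nonneg c₃]

end Summit.AtomisticToContinuum.Crystallization.Theorems.HullExactificationCascadeRobustBarlowTemplate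

end
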